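import Literature.AlgebraicGeometry.Motives.CurvePointDivisor
import Literature.AlgebraicGeometry.Motives.FamilyFiberCyclePrincipalDivisor
import Literature.AlgebraicGeometry.Motives.AbelianVarietyDegree
import Literature.AlgebraicGeometry.Motives.SymmetricPowerSplitDivisors
import Literature.AlgebraicGeometry.Motives.CartierDivisorProjectionFormula
import Literature.AlgebraicGeometry.Motives.CurveRiemannRoch
import Literature.AlgebraicGeometry.Motives.CurveGeneralDivisorsNonempty
import Literature.AlgebraicGeometry.Motives.ClosedGraphMorphism
import Literature.AlgebraicGeometry.Motives.SepQuotientPieces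
import Literature.AlgebraicGeometry.Motives.FiniteQuotientFunctionField
import HarnessLib

/-!
# `p^*[p x] = Σ_δ [δ·x]`: ramification of a Galois cover of smooth complex curves = stabiliser order (Hartshorne IV.2; SGA 1 V §1)

Topic `Literature/AlgebraicGeometry/Motives`, namespace `Literature.AlgebraicGeometry.Motives.CurvePlaces`.  PROOF FILE (theorems only;
no definition, no named fact, no instance, no `sorry`).  THE (RAM) LEAF of the G4 road of the cell `hodgecm-mathlib` (D-0151; crux HLiu418 =
stmt-HodgeConjecture-24832, d6 line; pen A-p04 (g17) ruling #3 (a) 2026-08-30T08:03Z): for a Galois cover `p : X → Y = X∕Δ` of smooth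
proper complex curves (`act : Δ →* Aut X` finite, `p` a quotient by `act` for separated test objects, ★ `IsSepQuotient`) it delivers the two
§2 binders `hram`∕`hfib` of the pen՚s sockets TOKEN FOR TOKEN — with the degree identity `[K(X):K(Y)] = |Δ|` ((RAM-1), A-p19 (g13)) as
the one explicit binder `hdeg`:

* §1 `ordAt_pullback_eq_ramification_mul` — **`ord_z(p^*E) = e_z · ord_{pz}(E)`**, `e_z := ord_z(p^*[p z])`, for ANY dominant `p` to a
  smooth curve (a local equation is `u·π^{ord}` for a uniformiser `π`, ★ `ord_functionFieldMap_eq_mul`; Hartshorne IV.2 `e_P = v_P(φ^♯ t)`).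
* §2 `ordAt_pullback_base_eq_of_iso_over` — `e` is invariant under automorphisms of `X` over `Y` (★ `ordAt_pullback_of_isIso`).
* §3 `exists_act_map_eq_of_map_eq` (= **`hfib`**) — the fibres of `p(ℂ)` are single `Δ`-orbits (★ `IsSepQuotient.exists_map_act_eq_of_map_eq`,
  SGA 1 V 1.1).
* §4 `card_orbit_mul_ramification_eq_finrank` — **`|Δ·x| · e_x = [K(X):K(Y)]`**: `deg_X p^*[q] = [K(X):K(Y)] · deg_Y [q]` (Fulton 2.3 (c), ★
  `map_cycle_pullback_eq_smul`), `deg_Y[q] = 1`, and `deg_X p^*[q] = Σ_{z ∈ Δ·x} e_z = |Δ·x| · e_x` (§1: support on the fibre; §2–§3: the fibre is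
  the orbit, `e` constant on it; complex points have residue degree `1`).
* §5 `ordAt_pullback_eq_card_stabilizer_mul` (= **`hram`**): with `hdeg : [K(X):K(Y)] = |Δ|` and orbit–stabiliser, `e_x = #Stab_Δ(x)`, hence
  `ord_x(p^*E) = #Stab_Δ(x) · ord_{px}(E)` for every `E`.
* §6 (ed. 2) `ordAt_pullback_eq_card_stabilizer_mul_of_injective` ∕ `…_of_isSmoothProjective` (= **`stub_ram`** of the G4 skeleton, token
  for token) — `hdeg` DISCHARGED for a faithful action (`Function.Injective act`) by ★ `finrank_functionField_of_isSepQuotient`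
  (`K(Y) = K(X)^Δ`, Artin ∕ SGA 1 V 1.1 ∕ Mumford AV §7; (RAM-1), A-p19 (g13)), Mumford՚s stable-affine-cover hypothesis being automatic for
  projective `X` (★ `ActionOver.forall_exists_stableAffineOpen_of_isProjectiveOver`).

COUNT-NEUTRAL capital (HC_CM is proved only modulo the 7 printed citations until rung 0 closes).

## References
* [Hartshorne1977] R. Hartshorne, *Algebraic Geometry* (1977), II.6 Prop. 6.11; IV.2 (ramification index `e_P = v_P(φ^* t)`, Prop. 2.2).
* [SGA1] A. Grothendieck, SGA 1, Exp. V §1, Prop. 1.1 (quotient by a finite group: fibres are orbits) and §2 (inertia groups).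
* [Fulton1998] W. Fulton, *Intersection Theory* (2nd ed.), Prop. 2.3 (c) (`f_*[f^*D] = deg(X'∕X)[D]`), Example 1.7.4.
* [GortzWedhorn2020] U. Görtz, T. Wedhorn, *Algebraic Geometry I* (2nd ed.), Def. 11.49 / Prop. 11.50 (b).
* [MumfordAV1970] D. Mumford, *Abelian Varieties* (1970), §7 Thm. p. 66 (quotient by a finite group; `K(X∕G) = K(X)^G`).
-/

noncomputable section

open CategoryTheory AlgebraicGeometry IsLocalRing Order

universe u

namespace Literature.AlgebraicGeometry.Motives

namespace CurvePlaces

open RatFn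

variable {K : Type u} [Field K] {X Y : SchemeOver K} [IsIntegral X.left] [IsIntegral Y.left]
  [SmoothOfRelativeDimension 1 Y.hom]

/-! ## §1 Multiplicativity: `ord_z(p^*E) = ord_z(p^*[p z]) · ord_{p z}(E)` -/

/-- **`ord_z(p^*E) = e_z · ord_{p z}(E)`, `e_z = ord_z(p^*[p z])`**: for a dominant `p : X → Y` to a smooth curve (`X` integral and locally
noetherian), a point `z` of `X` over a non-generic point of `Y`, and every Cartier divisor `E` on `Y`.  Both sides are computed with a
uniformiser `π` of `𝒪_{Y, p z}` (★ `ord_functionFieldMap_eq_mul`: `ord_z(p^♯ g) = ord_{pz}(g) · ord_z(p^♯ π)`), the local equation of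
`[p z]` having order one (★ `ordAt_pointDivisor_self`). [cite: Hartshorne1977, IV.2 (ramification index e_P = v_P(φ^* t)) and II.6 Prop. 6.11]
[cite: GortzWedhorn2020, Def. 11.49 and Prop. 11.50 (b) (pp. 315–316)] -/
theorem ordAt_pullback_eq_ramification_mul [IsLocallyNoetherian X.left] (p : X ⟶ Y) [IsDominant p.left]
    (E : CartierDivisor Y.left) (z : X.left) (hy : p.left.base z ≠ genericPoint Y.left) :
    (E.pullback p.left).ordAt z = ((pointDivisor Y hy).pullback p.left).ordAt z * E.ordAt (p.left.base z) := by
  haveI := isDiscreteValuationRing_stalk Y hy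
  have hyF : ¬ IsField (Y.left.presheaf.stalk (p.left.base z)) := IsDiscreteValuationRing.not_isField _
  obtain ⟨π, hπ⟩ := exists_maximalIdeal_stalk_eq_span Y (p.left.base z)
  -- `p^*E` at `z`: local equation `p^♯ f_i`
  obtain ⟨i, hi⟩ := E.covers (p.left.base z)
  have hzi : z ∈ (E.pullback p.left).U i := hi
  rw [CartierDivisor.ordAt_eq_ord _ hzi, CartierDivisor.pullback_f, CartierDivisor.ordAt_eq_ord _ hi,
    ord_functionFieldMap_eq_mul p.left z hyF hπ (E.f_ne_zero i)]
  -- `p^*[p z]` at `z`: local equation `p^♯ f_j` with `ord_{pz} f_j = 1`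
  obtain ⟨j, hj⟩ := (pointDivisor Y hy).covers (p.left.base z)
  have hzj : z ∈ ((pointDivisor Y hy).pullback p.left).U j := hj
  rw [CartierDivisor.ordAt_eq_ord _ hzj, CartierDivisor.pullback_f,
    ord_functionFieldMap_eq_mul p.left z hyF hπ ((pointDivisor Y hy).f_ne_zero j), ← CartierDivisor.ordAt_eq_ord _ hj,
    ordAt_pointDivisor_self hy, one_mul, mul_comm]

/-- **The ramification index does not depend on the choice involved**: `ord_z(p^*[y])` for ANY non-generic `y` with `p z = y`, as a
rewriting of `ordAt_pullback_eq_ramification_mul` along `y = p z` (bookkeeping). [cite: Hartshorne1977, IV.2 (ramification index)] -/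
theorem ordAt_pullback_eq_ramification_mul' [IsLocallyNoetherian X.left] (p : X ⟶ Y) [IsDominant p.left]
    (E : CartierDivisor Y.left) (z : X.left) {y : Y.left} (hy : y ≠ genericPoint Y.left) (hzy : p.left.base z = y) :
    (E.pullback p.left).ordAt z = ((pointDivisor Y hy).pullback p.left).ordAt z * E.ordAt y := by
  subst hzy
  exact ordAt_pullback_eq_ramification_mul p E z hy

/-- **Off the fibre the pulled-back point divisor has order zero**: if `p z ≠ y` then `ord_z(p^*[y]) = 0` (`ord_{p z}[y] = 0`,
★ `ordAt_pointDivisor_of_ne`). [cite: Hartshorne1977, II.6 Prop. 6.11 and IV.2] -/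
theorem ordAt_pullback_pointDivisor_eq_zero_of_ne [IsLocallyNoetherian X.left] (p : X ⟶ Y) [IsDominant p.left]
    {y : Y.left} (hy : y ≠ genericPoint Y.left) (z : X.left) (hzy : p.left.base z ≠ y)
    (hz : p.left.base z ≠ genericPoint Y.left) : ((pointDivisor Y hy).pullback p.left).ordAt z = 0 := by
  rw [ordAt_pullback_eq_ramification_mul p (pointDivisor Y hy) z hz, ordAt_pointDivisor_of_ne hy hzy, mul_zero]

/-! ## §2 Invariance under automorphisms over the base -/

omit [SmoothOfRelativeDimension 1 Y.hom] in
/-- **`ord_{g z}(p^*E) = ord_z(p^*E)` for an automorphism `g` of `X` over `Y`** (`g ≫ p = p`): `ord` is invariant under isomorphisms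
(★ `CartierDivisor.ordAt_pullback_of_isIso`) and `g^*(p^*E) = (g ≫ p)^*E = p^*E` as divisors (★ `pullback_pullback_sameDivisor`,
`pullback_congr_sameDivisor`).  Consequently the ramification index of `p` is constant along the orbits of any group of automorphisms of
`X` over `Y` (deck transformations of a Galois cover). [cite: Hartshorne1977, IV.2 (ramification index) and II.6]
[cite: GortzWedhorn2020, Def. 11.49 and Prop. 11.50 (b) (pp. 315–316)] -/
theorem ordAt_pullback_base_eq_of_iso_over [SmoothOfRelativeDimension 1 X.hom] (p : X ⟶ Y) [IsDominant p.left]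
    (g : X ≅ X) (hg : g.hom ≫ p = p) (E : CartierDivisor Y.left) (z : X.left) (hz : z ≠ genericPoint X.left)
    (hgz : g.hom.left.base z ≠ genericPoint X.left) :
    (E.pullback p.left).ordAt (g.hom.left.base z) = (E.pullback p.left).ordAt z := by
  haveI : IsIso g.hom.left := (inferInstance : IsIso ((Over.forget _).mapIso g).hom)
  haveI := isDiscreteValuationRing_stalk X hz
  haveI := isDiscreteValuationRing_stalk X hgz
  rw [← CartierDivisor.ordAt_pullback_of_isIso (E.pullback p.left) (g := g.hom.left) z]
  have h1 : ((E.pullback p.left).pullback g.hom.left).SameDivisor (E.pullback (g.hom.left ≫ p.left)) :=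
    CartierDivisor.pullback_pullback_sameDivisor E p.left g.hom.left
  have h2 : (E.pullback (g.hom.left ≫ p.left)).SameDivisor (E.pullback p.left) :=
    CartierDivisor.pullback_congr_sameDivisor E (by rw [← Over.comp_left, hg])
  rw [h1.ordAt_eq z, h2.ordAt_eq z]


/-! ## §3 Complex points of a smooth curve; fibres of a finite quotient are orbits (`hfib`) -/

/-- Push-forward of cycles along equal morphisms (bookkeeping). [folklore] -/
private theorem algebraicCycleMap_congr' {X' Y' : Scheme.{0}} {f₁ f₂ : X' ⟶ Y'} (h : f₁ = f₂) [QuasiCompact f₁] [QuasiCompact f₂]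
    (c : AlgebraicCycle X' ℤ) : AlgebraicCycle.map f₁ height height c = AlgebraicCycle.map f₂ height height c := by
  subst h; rfl

section Points

variable (C : SchemeOver ℂ) [IsIntegral C.left] [SmoothOfRelativeDimension 1 C.hom]

/-- The point of a complex point of the smooth curve `C` is not the generic point (twin of ★ `HodgeTheory.CurvePoleSpaces.pt_ne_genericPoint`,
kept here to spare the analytic imports). [folklore] -/
private theorem pt_ne_genericPoint' (P : AlgPoints C ℂ) : P.pt ≠ genericPoint C.left := by
  intro h
  have hcl : IsClosed ({P.pt} : Set C.left) := P.isClosed_singleton_pt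
  have hall : ∀ y : C.left, y = P.pt := fun y => by
    have hy : y ∈ closure {genericPoint C.left} := by rw [(genericPoint_spec _).def]; trivial
    rw [← h, hcl.closure_eq] at hy
    exact hy
  have h1 := height_top_of_smoothCurve C
  have hne : ¬ IsMin (⊤ : ↥C.left) := by rw [← Order.height_eq_zero, h1]; decide
  obtain ⟨b, hb⟩ := not_isMin_iff.mp hne
  exact hb.ne ((hall b).trans (hall ⊤).symm)

omit [IsIntegral C.left] in
/-- Complex points of `C` with the same underlying point are equal (★ `AlgPoints.eq_of_pt_eq`). [folklore] -/
private theorem eq_of_pt_eq' {P Q : AlgPoints C ℂ} (h : P.pt = Q.pt) : P = Q := by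
  haveI : Smooth C.hom := SmoothOfRelativeDimension.smooth 1 C.hom
  exact AlgPoints.eq_of_pt_eq h

omit [IsIntegral C.left] [SmoothOfRelativeDimension 1 C.hom] in
/-- A complex point has residue degree one over `Spec ℂ` (twin of ★ `HodgeTheory.CurvePoleSpaces.residueDegree_pt`). [folklore] -/
private theorem residueDegree_pt' (P : AlgPoints C ℂ) : C.hom.residueDegree P.pt = 1 := by
  have hw : P.left ≫ C.hom = 𝟙 _ := by
    rw [Over.w P]
    change Spec.map (CommRingCat.ofHom (algebraMap ℂ ℂ)) = 𝟙 _
    rw [Algebra.algebraMap_self, CommRingCat.ofHom_id, Spec.map_id]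
  exact FieldPoint.residueDegree_eq_one_of_section C.hom hw

/-- The generic point of the proper curve `C` contributes nothing to degrees: its residue degree over `Spec ℂ` (`finrank_ℂ K(C)`,
infinite-dimensional) is `0`. [cite: Fulton1998, Definition 1.4 (p. 13)] -/
private theorem residueDegree_toSpecOver_genericPoint [IsProper C.hom] :
    (toSpecOver C).left.residueDegree (genericPoint C.left) = 0 := by
  have h := CartierDivisor.mapCoeff_toSpecOver_eq (C := C) (genericPoint C.left)
  haveI : Subsingleton ↥(specOver ℂ ℂ).left := inferInstanceAs (Subsingleton (PrimeSpectrum ℂ))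
  have h0 : height ((toSpecOver C).left.base (genericPoint C.left)) = 0 := by
    rw [Order.height_eq_zero]; intro b _; exact (Subsingleton.elim _ b).le
  have h1 : height (genericPoint C.left) = 1 := height_top_of_smoothCurve C
  unfold AlgebraicCycle.mapCoeff at h
  rw [h0, h1, if_neg one_ne_zero] at h
  exact h.symm

end Points

section Complex

variable {X Y : SchemeOver ℂ} [IsIntegral X.left] [SmoothOfRelativeDimension 1 X.hom]
  [IsIntegral Y.left] [SmoothOfRelativeDimension 1 Y.hom]
  {Δ : Type} [Group Δ] [Fintype Δ] (act : Δ →* Aut X) (p : X ⟶ Y)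

omit [SmoothOfRelativeDimension 1 X.hom] [IsIntegral X.left] [IsIntegral Y.left] [SmoothOfRelativeDimension 1 Y.hom] [Fintype Δ] in
/-- **`hfib` — the fibres of `p(ℂ)` are single `Δ`-orbits**: two complex points of `X` with the same image under the quotient map differ by
some `act δ` (★ `IsSepQuotient.exists_map_act_eq_of_map_eq`: `Y ≅ X∕Δ` and the fibres of `π(ℂ)` are the orbits). [cite: SGA1, Exp. V, Prop. 1.1]
[cite: MumfordAV1970, §7 Thm. p. 66 (1)] -/
theorem exists_act_map_eq_of_map_eq [Finite Δ] (hXp : IsProjectiveOver X) [IsProper Y.hom]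
    (hp : IsSepQuotient (fun δ : Δ => act δ) p) (w x : AlgPoints X ℂ) (h : AlgPoints.map p w = AlgPoints.map p x) :
    ∃ δ : Δ, AlgPoints.map (act δ).hom w = x :=
  IsSepQuotient.exists_map_act_eq_of_map_eq act p hXp (inferInstance : IsSeparated Y.hom) hp h

/-! ## §4 The degree count: `|Δ·x| · e_x = [K(X):K(Y)]` -/

omit [Fintype Δ] in
/-- **`deg p^*D = [K(X):K(Y)] · deg D`** for a proper dominant morphism of integral proper complex curves (functoriality of proper
push-forward + ★ `CartierDivisor.map_cycle_pullback_eq_smul`, Fulton Prop. 2.3 (c); twin of the private lemma of ★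
`Resolution/Lipman1969ProperTransformHolds`). [cite: Fulton1998, Prop. 2.3 (c) (proof, p. 34)] -/
theorem degree_pullback_eq_finrank_mul [IsProper X.hom] [IsProper Y.hom] [IsProper p.left] [IsDominant p.left]
    (D : CartierDivisor Y.left) :
    CartierDivisor.degree X (D.pullback p.left) =
      (letI := (functionFieldMap p.left).toAlgebra; (Module.finrank Y.left.functionField X.left.functionField : ℤ)) *
        CartierDivisor.degree Y D := by
  letI := (functionFieldMap p.left).toAlgebra
  have e : (toSpecOver X).left = p.left ≫ (toSpecOver Y).left := (Over.w p).symm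
  have hzsmul : ∀ (m : ℤ) (c : AlgebraicCycle Y.left ℤ),
      AlgebraicCycle.map (toSpecOver Y).left height height (m • c) = m • AlgebraicCycle.map (toSpecOver Y).left height height c :=
    fun m c => map_zsmul (AddMonoidHom.mk' (AlgebraicCycle.map (toSpecOver Y).left height height)
      (algebraicCycleMap_add (toSpecOver Y).left height height)) m c
  haveI : QuasiCompact (p.left ≫ (toSpecOver Y).left) := by rw [← e]; infer_instance
  unfold CartierDivisor.degree
  rw [algebraicCycleMap_congr' e,
    algebraicCycleMap_comp p.left (toSpecOver Y).left p.left.isClosedMap (toSpecOver Y).left.isClosedMap,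
    CartierDivisor.map_cycle_pullback_eq_smul p (height_top_of_smoothCurve X) (height_top_of_smoothCurve Y) D, hzsmul]
  rfl

/-- **`|Δ·x| · e_x = [K(X):K(Y)]`.**  For a quotient `p : X → Y` of the smooth projective complex curve `X` by the finite group `Δ` (for
separated test objects) and a complex point `x`: the number of points of the orbit `Δ·x` times the ramification index
`e_x = ord_x(p^*[p x])` is the degree `[K(X):K(Y)]` — `deg_X p^*[p x] = [K(X):K(Y)] · deg_Y [p x] = [K(X):K(Y)]`, while `p^*[p x]` is
supported on the fibre `p⁻¹(p x) = Δ·x` (§1, §3) with the constant multiplicity `e_x` (§2) at points of residue degree `1`.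
[cite: Hartshorne1977, IV.2 Prop. 2.2] [cite: Fulton1998, Prop. 2.3 (c) and Example 1.7.4] [cite: SGA1, Exp. V, Prop. 1.1] -/
theorem ncard_orbit_mul_ramification_eq_finrank (hXp : IsProjectiveOver X) [IsProper X.hom] [IsProper Y.hom] [IsDominant p.left]
    (hp : IsSepQuotient (fun δ : Δ => act δ) p) (x : AlgPoints X ℂ) :
    ((Set.range fun δ : Δ => AlgPoints.map (act δ).hom x).ncard : ℤ) *
        ((pointDivisor Y (pt_ne_genericPoint' Y (AlgPoints.map p x))).pullback p.left).ordAt x.pt =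
      (letI := (functionFieldMap p.left).toAlgebra; (Module.finrank Y.left.functionField X.left.functionField : ℤ)) := by
  classical
  haveI : Smooth X.hom := SmoothOfRelativeDimension.smooth 1 X.hom
  haveI : Smooth Y.hom := SmoothOfRelativeDimension.smooth 1 Y.hom
  haveI : IsProper (p.left ≫ Y.hom) := by rw [Over.w p]; infer_instance
  haveI : IsProper p.left := IsProper.of_comp p.left Y.hom
  set q := AlgPoints.map p x with hq_def
  set D := (pointDivisor Y (pt_ne_genericPoint' Y q)).pullback p.left with hD
  have hfin : (Set.range fun δ : Δ => AlgPoints.map (act δ).hom x).Finite := Set.finite_range _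
  set S : Finset (AlgPoints X ℂ) := hfin.toFinset with hS
  have hmemS : ∀ P, P ∈ S ↔ ∃ δ, AlgPoints.map (act δ).hom x = P := fun P => by
    rw [hS, Set.Finite.mem_toFinset, Set.mem_range]
  -- the degree of `p^*[q]` is `[K(X):K(Y)]`
  have hdeg : CartierDivisor.degree X D =
      (letI := (functionFieldMap p.left).toAlgebra; (Module.finrank Y.left.functionField X.left.functionField : ℤ)) := by
    rw [hD, degree_pullback_eq_finrank_mul p, degree_pointDivisor, residueDegree_pt', Nat.cast_one, mul_one]
  rw [Set.ncard_eq_toFinset_card _ hfin, ← hdeg, CartierDivisor.degree_eq_finsum]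
  -- evaluate the finite sum: support on `pt '' S`, constant value `e_x` there
  have hval : ∀ P ∈ S, D.ordAt P.pt * ((toSpecOver X).left.residueDegree P.pt : ℤ) = D.ordAt x.pt := by
    intro P hP
    obtain ⟨δ, rfl⟩ := (hmemS P).mp hP
    have hres : (toSpecOver X).left.residueDegree (AlgPoints.map (act δ).hom x).pt = 1 := residueDegree_pt' X _
    rw [hres, Nat.cast_one, mul_one]
    exact ordAt_pullback_base_eq_of_iso_over p (act δ) (hp.1 δ) _ x.pt (pt_ne_genericPoint' X x)
      (pt_ne_genericPoint' X (AlgPoints.map (act δ).hom x))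
  have hzero : ∀ z : X.left, z ∉ S.image (fun P : AlgPoints X ℂ => P.pt) →
      D.ordAt z * ((toSpecOver X).left.residueDegree z : ℤ) = 0 := by
    intro z hz
    by_cases hη : z = genericPoint X.left
    · rw [hη, residueDegree_toSpecOver_genericPoint X, Nat.cast_zero, mul_zero]
    · obtain ⟨P, rfl⟩ := AlgPoints.exists_pt_eq_of_isClosed_singleton (K := ℂ) (isClosed_singleton X hη)
      have hPS : P ∉ S := fun hPS => hz (Finset.mem_image_of_mem _ hPS)
      have hne : p.left.base P.pt ≠ q.pt := by
        intro hpt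
        have hpq : AlgPoints.map p P = q := eq_of_pt_eq' Y hpt
        obtain ⟨δ, hδ⟩ := exists_act_map_eq_of_map_eq act p hXp hp x P (hq_def.symm.trans hpq.symm)
        exact hPS ((hmemS P).mpr ⟨δ, hδ⟩)
      rw [hD, ordAt_pullback_pointDivisor_eq_zero_of_ne p _ P.pt hne (pt_ne_genericPoint' Y (AlgPoints.map p P)), zero_mul]
  rw [finsum_eq_sum_of_support_subset _ (s := S.image fun P : AlgPoints X ℂ => P.pt) (fun z hz => by
      by_contra hzS; exact hz (hzero z hzS)),
    Finset.sum_image fun P _ Q _ h => eq_of_pt_eq' X h, Finset.sum_congr rfl hval, Finset.sum_const, nsmul_eq_mul]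

/-! ## §5 Orbit–stabiliser: `e_x = #Stab_Δ(x)` and the letter `hram` -/

/-- **`hram` — RAMIFICATION = STABILISER ORDER, multiplicative in `E`**: for a quotient `p : X → Y = X∕Δ` of smooth proper complex curves
(`X` projective) and `[K(X):K(Y)] = |Δ|` (the binder `hdeg`, (RAM-1)), at every complex point `x` and for every Cartier divisor `E` on `Y`:
`ord_x(p^*E) = #Stab_Δ(x) · ord_{p x}(E)`.  (§1: `ord_x(p^*E) = e_x · ord_{px}(E)`; §4: `|Δ·x| · e_x = |Δ|`; orbit–stabiliser
`|Δ·x| · #Stab(x) = |Δ|`, Mathlib `MulAction.index_stabilizer` ∕ `Subgroup.index_mul_card` for the action `δ ↦ act δ` on `X(ℂ)`.)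
[cite: Hartshorne1977, IV.2 Prop. 2.2] [cite: SGA1, Exp. V, Prop. 1.1 and §2] [cite: Fulton1998, Example 1.7.4] -/
theorem ordAt_pullback_eq_card_stabilizer_mul (hXp : IsProjectiveOver X) [IsProper X.hom] [IsProper Y.hom] [IsDominant p.left]
    (hp : IsSepQuotient (fun δ : Δ => act δ) p)
    (hdeg : letI := (functionFieldMap p.left).toAlgebra; Module.finrank Y.left.functionField X.left.functionField = Fintype.card Δ)
    (E : CartierDivisor Y.left) (x : AlgPoints X ℂ) :
    (E.pullback p.left).ordAt x.pt = Nat.card {δ : Δ // AlgPoints.map (act δ).hom x = x} * E.ordAt (AlgPoints.map p x).pt := by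
  haveI : Smooth X.hom := SmoothOfRelativeDimension.smooth 1 X.hom
  -- the action of `Δ` on complex points
  letI : MulAction Δ (AlgPoints X ℂ) :=
    { smul := fun δ P => AlgPoints.map (act δ).hom P
      one_smul := fun P => by
        change AlgPoints.map (act 1).hom P = P
        rw [map_one]; exact AlgPoints.map_id_apply P
      mul_smul := fun a b P => by
        change AlgPoints.map (act (a * b)).hom P = AlgPoints.map (act a).hom (AlgPoints.map (act b).hom P)
        rw [map_mul, ← AlgPoints.map_comp_apply]; rfl }
  -- §1 at `x`
  rw [ordAt_pullback_eq_ramification_mul p E x.pt (pt_ne_genericPoint' Y (AlgPoints.map p x))]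
  congr 1
  -- `|Δ·x| · e_x = |Δ| = |Δ·x| · #Stab(x)`
  have hcount := ncard_orbit_mul_ramification_eq_finrank act p hXp hp x
  rw [hdeg] at hcount
  have hos : (MulAction.orbit Δ x).ncard * Nat.card (MulAction.stabilizer Δ x) = Nat.card Δ := by
    rw [← MulAction.index_stabilizer, Subgroup.index_mul_card]
  have horb : MulAction.orbit Δ x = Set.range fun δ : Δ => AlgPoints.map (act δ).hom x := rfl
  have hstab : Nat.card (MulAction.stabilizer Δ x) = Nat.card {δ : Δ // AlgPoints.map (act δ).hom x = x} :=
    Nat.card_congr (Equiv.subtypeEquivRight fun δ => MulAction.mem_stabilizer_iff)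
  rw [horb, hstab, Nat.card_eq_fintype_card (α := Δ)] at hos
  have hpos : 0 < (Set.range fun δ : Δ => AlgPoints.map (act δ).hom x).ncard :=
    (Set.ncard_pos (Set.finite_range _)).mpr ⟨AlgPoints.map (act 1).hom x, 1, rfl⟩
  have key : ((Set.range fun δ : Δ => AlgPoints.map (act δ).hom x).ncard : ℤ) *
      ((pointDivisor Y (pt_ne_genericPoint' Y (AlgPoints.map p x))).pullback p.left).ordAt x.pt =
      ((Set.range fun δ : Δ => AlgPoints.map (act δ).hom x).ncard : ℤ) * (Nat.card {δ : Δ // AlgPoints.map (act δ).hom x = x} : ℤ) := by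
    rw [hcount, ← Nat.cast_mul, hos]
  exact mul_left_cancel₀ (by exact_mod_cast hpos.ne') key

/-! ### §6 The `hdeg` binder discharged: `[K(X) : K(Y)] = |Δ|` for a faithful action (★ `finrank_functionField_of_isSepQuotient`) -/

/-- **`hram` of the G4 sockets, unconditionally: `ord_x(p^*E) = #Stab_Δ(x) · ord_{p(x)}(E)`** for a
quotient `p : X → Y ≅ X∕Δ` of smooth proper complex curves by a FAITHFUL finite group of automorphisms
`act : Δ ↪ Aut X`.  This is §5 `ordAt_pullback_eq_card_stabilizer_mul` with its degree binder
`hdeg : [K(X) : K(Y)] = |Δ|` discharged by the tree's `finrank_functionField_of_isSepQuotient`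
(`K(Y) = K(X)^Δ`, Artin; SGA 1 V Prop. 1.1 / Mumford AV §7), whose Mumford hypothesis "every point lies in
a `Δ`-stable affine open" is automatic for projective `X`
(`ActionOver.forall_exists_stableAffineOpen_of_isProjectiveOver`). [cite: SGA1, Exp. V, Prop. 1.1 and Prop. 1.8]
[cite: Hartshorne1977, Ch. II, Prop. 6.9, p. 138] [cite: MumfordAV1970, §7 Thm. p. 66] -/
theorem ordAt_pullback_eq_card_stabilizer_mul_of_injective (hXp : IsProjectiveOver X) [IsProper X.hom] [IsProper Y.hom]
    [IsDominant p.left] (hact : Function.Injective act) (hp : IsSepQuotient (fun δ : Δ => act δ) p)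
    (E : CartierDivisor Y.left) (x : AlgPoints X ℂ) :
    (E.pullback p.left).ordAt x.pt = Nat.card {δ : Δ // AlgPoints.map (act δ).hom x = x} * E.ordAt (AlgPoints.map p x).pt :=
  ordAt_pullback_eq_card_stabilizer_mul act p hXp hp
    (finrank_functionField_of_isSepQuotient act hact
      (Literature.AlgebraicGeometry.RelativeSpec.ActionOver.forall_exists_stableAffineOpen_of_isProjectiveOver _ hXp)
      p (inferInstance : IsSeparated Y.hom) hp) E x

end Complex

section G4Socket

/-- **`stub_ram` of the G4 skeleton, token for token**: for smooth projective complex curves `X`, `Y`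
(`IsSmoothProjective 1`, with the skeleton՚s `IsLocallyNoetherian` binders), a faithful finite group `act : Δ ↪ Aut X` and a quotient `p : X → Y ≅ X∕Δ`
(`IsSepQuotient`), `ord_x(p^*E) = #Stab_Δ(x) · ord_{p(x)}(E)` for every Cartier divisor `E` on `Y` and every
complex point `x` of `X` — `ordAt_pullback_eq_card_stabilizer_mul_of_injective` with the smoothness /
properness instances read off `IsSmoothProjective`. [cite: SGA1, Exp. V, Prop. 1.1 and Prop. 1.8]
[cite: Hartshorne1977, Ch. II, Prop. 6.9, p. 138] [cite: MumfordAV1970, §7 Thm. p. 66] -/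
theorem ordAt_pullback_eq_card_stabilizer_mul_of_isSmoothProjective {X Y : SchemeOver ℂ}
    (hX : IsSmoothProjective 1 X) (hY : IsSmoothProjective 1 Y)
    [IsIntegral X.left] [IsLocallyNoetherian X.left] [IsIntegral Y.left] [IsLocallyNoetherian Y.left]
    {Δ : Type} [Group Δ] [Fintype Δ] (act : Δ →* Aut X) (hact : Function.Injective act)
    (p : X ⟶ Y) (hp : IsSepQuotient (fun δ : Δ => act δ) p) [IsDominant p.left]
    (E : CartierDivisor Y.left) (x : AlgPoints X ℂ) :
    (E.pullback p.left).ordAt x.pt = Nat.card {δ : Δ // AlgPoints.map (act δ).hom x = x} * E.ordAt (AlgPoints.map p x).pt := by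
  haveI := hX.smoothOfRelativeDimension
  haveI := hY.smoothOfRelativeDimension
  haveI : IsProper X.hom := hX.isProjectiveOver.isProper
  haveI : IsProper Y.hom := hY.isProjectiveOver.isProper
  exact ordAt_pullback_eq_card_stabilizer_mul_of_injective act p hX.isProjectiveOver hact hp E x

end G4Socket

end CurvePlaces

end Literature.AlgebraicGeometry.Motives

end
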